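import Literature.AlgebraicTopology.KTheory.ReducedSphereVanishing
import Literature.AlgebraicTopology.KTheory.BottReduced
import HarnessLib

/-!
# The `K̃`-cup product `K̃(X) ⊗ K̃(Y) → K̃(X ∧ Y)` and relative products — scratch
-/

noncomputable section

open Set Metric TopologicalSpace

namespace Literature.AlgebraicTopology.KTheory

open Literature.RingTheory.KTheory

universe u v

/-! ### The smash product `X ∧ Y = (X × Y)/(X ∨ Y)` and the `K̃`-cup product -/

section SmashProd

variable {X : Type u} [TopologicalSpace X] [CompactSpace X] [T2Space X]
variable {Y : Type v} [TopologicalSpace Y] [CompactSpace Y] [T2Space Y]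

/-- The smash product `X ∧ Y` (base points `x₀`, `y₀`) as the collapse of the wedge. [folklore] -/
abbrev Smash (x₀ : X) (y₀ : Y) : Type (max u v) := Collapse (X × Y) (prodWedgeC x₀ y₀)

/-- The external product `pr₁^*a · pr₂^*b ∈ K⁰(X × Y)`. [cite: HusemollerFibreBundles1994, Ch. 10 Def. 3.1] -/
abbrev eprod (a : K0 X) (b : K0 Y) : K0 (X × Y) := pullback ContinuousMap.fst a * pullback ContinuousMap.snd b

omit [CompactSpace X] [T2Space X] [CompactSpace Y] [T2Space Y] in
/-- The external product of reduced classes vanishes on the slice `X × {y₀}`. [cite: HusemollerFibreBundles1994, Ch. 10 Prop. 3.5] -/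
theorem pullback_sliceLeft_eprod {y₀ : Y} (a : K0 X) {b : K0 Y} (hb : b ∈ Reduced Y y₀) :
    pullback ((ContinuousMap.id X).prodMk (ContinuousMap.const X y₀)) (eprod a b) = 0 := by
  rw [pullback_mul, pullback_sliceLeft_pullback_fst, pullback_sliceLeft_pullback_snd, mem_reduced_iff.1 hb, map_zero, mul_zero]

omit [CompactSpace X] [T2Space X] [CompactSpace Y] [T2Space Y] in
/-- The external product of reduced classes vanishes on the slice `{x₀} × Y`. [cite: HusemollerFibreBundles1994, Ch. 10 Prop. 3.5] -/
theorem pullback_sliceRight_eprod {x₀ : X} {a : K0 X} (ha : a ∈ Reduced X x₀) (b : K0 Y) :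
    pullback ((ContinuousMap.const Y x₀).prodMk (ContinuousMap.id Y)) (eprod a b) = 0 := by
  rw [pullback_mul, pullback_sliceRight_pullback_fst, pullback_sliceRight_pullback_snd, mem_reduced_iff.1 ha, map_zero, zero_mul]

/-- The external product of reduced classes vanishes on the wedge. [cite: HusemollerFibreBundles1994, Ch. 10 Prop. 3.5] -/
theorem resK_prodWedge_eprod {x₀ : X} {y₀ : Y} {a : K0 X} (ha : a ∈ Reduced X x₀) {b : K0 Y} (hb : b ∈ Reduced Y y₀) :
    resK (prodWedgeC x₀ y₀) (eprod a b) = 0 := by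
  refine eq_zero_of_pullback_wedge_eq_zero x₀ y₀ _ ?_ ?_
  · rw [resK, ← AddMonoidHom.comp_apply, ← pullback_comp]; exact pullback_sliceLeft_eprod a hb
  · rw [resK, ← AddMonoidHom.comp_apply, ← pullback_comp]; exact pullback_sliceRight_eprod ha b

omit [CompactSpace X] [CompactSpace Y] in
/-- **Uniqueness of reduced lifts**: a reduced class on `X ∧ Y` is determined by its pull-back to
`X × Y` (Husemöller 10 (3.4): `K̃(X ∧ Y) → K̃(X × Y)` is a monomorphism). [cite: HusemollerFibreBundles1994, Ch. 10 Prop. 3.4] -/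
theorem reduced_smash_ext (x₀ : X) (y₀ : Y) {c c' : K0 (Smash x₀ y₀)} (hc : c ∈ Reduced (Smash x₀ y₀) (Collapse.pt _)) (hc' : c' ∈ Reduced (Smash x₀ y₀) (Collapse.pt _))
    (h : quotK (prodWedgeC x₀ y₀) c = quotK (prodWedgeC x₀ y₀) c') : c = c' := by
  rw [← sub_eq_zero]
  exact eq_zero_of_quotK_prodWedge_eq_zero x₀ y₀ (sub_mem hc hc') (by rw [map_sub, h, sub_self])

/-- **The `K̃`-cup product `K̃(X) ⊗ K̃(Y) → K̃(X ∧ Y)`**: the unique reduced class on `X ∧ Y` pulling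
back to `pr₁^*a · pr₂^*b` (Husemöller 10 Rem. 3.6). [cite: HusemollerFibreBundles1994, Ch. 10 Rem. 3.6] -/
def smashProd (x₀ : X) (y₀ : Y) (a : Reduced X x₀) (b : Reduced Y y₀) : Reduced (Smash x₀ y₀) (Collapse.pt _) :=
  ⟨Classical.choose (exists_reduced_quotK_eq (eprod (a : K0 X) (b : K0 Y)) (resK_prodWedge_eprod a.2 b.2)),
    (Classical.choose_spec (exists_reduced_quotK_eq (eprod (a : K0 X) (b : K0 Y)) (resK_prodWedge_eprod a.2 b.2))).1⟩

/-- `q^*(a ∧ b) = pr₁^*a · pr₂^*b`. [cite: HusemollerFibreBundles1994, Ch. 10 Rem. 3.6] -/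
theorem quotK_smashProd (x₀ : X) (y₀ : Y) (a : Reduced X x₀) (b : Reduced Y y₀) :
    quotK (prodWedgeC x₀ y₀) (smashProd x₀ y₀ a b : K0 (Smash x₀ y₀)) = eprod (a : K0 X) (b : K0 Y) :=
  (Classical.choose_spec (exists_reduced_quotK_eq (eprod (a : K0 X) (b : K0 Y)) (resK_prodWedge_eprod a.2 b.2))).2

/-- `q^*(a ∧ b) = pr₁^*a · pr₂^*b`, with `q^*` spelled as a pull-back. [cite: HusemollerFibreBundles1994, Ch. 10 Rem. 3.6] -/
theorem pullback_mk_smashProd (x₀ : X) (y₀ : Y) (a : Reduced X x₀) (b : Reduced Y y₀) :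
    pullback (Collapse.mk (prodWedgeC x₀ y₀)) (smashProd x₀ y₀ a b : K0 (Smash x₀ y₀)) = eprod (a : K0 X) (b : K0 Y) :=
  quotK_smashProd x₀ y₀ a b

/-- Characterisation of `a ∧ b` by its pull-back. [cite: HusemollerFibreBundles1994, Ch. 10 Rem. 3.6] -/
theorem smashProd_eq_of_quotK_eq (x₀ : X) (y₀ : Y) (a : Reduced X x₀) (b : Reduced Y y₀) {c : K0 (Smash x₀ y₀)} (hc : c ∈ Reduced (Smash x₀ y₀) (Collapse.pt _))
    (h : quotK (prodWedgeC x₀ y₀) c = eprod (a : K0 X) (b : K0 Y)) : (smashProd x₀ y₀ a b : K0 (Smash x₀ y₀)) = c :=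
  reduced_smash_ext x₀ y₀ (smashProd x₀ y₀ a b).2 hc ((quotK_smashProd x₀ y₀ a b).trans h.symm)

/-- Bilinearity (left). [cite: HusemollerFibreBundles1994, Ch. 10 Rem. 3.6] -/
theorem smashProd_add_left (x₀ : X) (y₀ : Y) (a a' : Reduced X x₀) (b : Reduced Y y₀) :
    smashProd x₀ y₀ (a + a') b = smashProd x₀ y₀ a b + smashProd x₀ y₀ a' b := by
  apply Subtype.ext
  refine (smashProd_eq_of_quotK_eq x₀ y₀ _ _ (add_mem (smashProd x₀ y₀ a b).2 (smashProd x₀ y₀ a' b).2) ?_)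
  rw [AddSubgroup.coe_add, map_add, quotK_smashProd, quotK_smashProd, AddSubgroup.coe_add]
  simp only [eprod, map_add, add_mul]

/-- Bilinearity (right). [cite: HusemollerFibreBundles1994, Ch. 10 Rem. 3.6] -/
theorem smashProd_add_right (x₀ : X) (y₀ : Y) (a : Reduced X x₀) (b b' : Reduced Y y₀) :
    smashProd x₀ y₀ a (b + b') = smashProd x₀ y₀ a b + smashProd x₀ y₀ a b' := by
  apply Subtype.ext
  refine (smashProd_eq_of_quotK_eq x₀ y₀ _ _ (add_mem (smashProd x₀ y₀ a b).2 (smashProd x₀ y₀ a b').2) ?_)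
  rw [AddSubgroup.coe_add, map_add, quotK_smashProd, quotK_smashProd, AddSubgroup.coe_add]
  simp only [eprod, map_add, mul_add]

/-- K-theory of spheres (Hatcher VBKT §2). [folklore] -/
theorem smashProd_zero_left (x₀ : X) (y₀ : Y) (b : Reduced Y y₀) : smashProd x₀ y₀ 0 b = 0 := by
  have h := smashProd_add_left x₀ y₀ 0 0 b
  rw [add_zero] at h
  exact left_eq_add.1 h

/-- K-theory of spheres (Hatcher VBKT §2). [folklore] -/
theorem smashProd_zero_right (x₀ : X) (y₀ : Y) (a : Reduced X x₀) : smashProd x₀ y₀ a 0 = 0 := by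
  have h := smashProd_add_right x₀ y₀ a 0 0
  rw [add_zero] at h
  exact left_eq_add.1 h

/-- K-theory of spheres (Hatcher VBKT §2). [folklore] -/
theorem smashProd_neg_left (x₀ : X) (y₀ : Y) (a : Reduced X x₀) (b : Reduced Y y₀) : smashProd x₀ y₀ (-a) b = -smashProd x₀ y₀ a b := by
  have h := smashProd_add_left x₀ y₀ a (-a) b
  rw [add_neg_cancel, smashProd_zero_left] at h
  exact (neg_eq_of_add_eq_zero_right h.symm).symm

/-- K-theory of spheres (Hatcher VBKT §2). [folklore] -/
theorem smashProd_zsmul_left (x₀ : X) (y₀ : Y) (k : ℤ) (a : Reduced X x₀) (b : Reduced Y y₀) : smashProd x₀ y₀ (k • a) b = k • smashProd x₀ y₀ a b := by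
  apply Subtype.ext
  refine (smashProd_eq_of_quotK_eq x₀ y₀ _ _ (zsmul_mem (smashProd x₀ y₀ a b).2 k) ?_)
  rw [AddSubgroup.coe_zsmul, map_zsmul, quotK_smashProd, AddSubgroup.coe_zsmul]
  simp only [eprod, map_zsmul, smul_mul_assoc]

/-! ### Naturality of the `K̃`-cup product -/

variable {X' : Type u} [TopologicalSpace X'] [CompactSpace X'] [T2Space X']
variable {Y' : Type v} [TopologicalSpace Y'] [CompactSpace Y'] [T2Space Y']

omit [CompactSpace X] [T2Space X] [CompactSpace Y] [T2Space Y] [CompactSpace X'] [T2Space X'] [CompactSpace Y'] [T2Space Y'] in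
/-- K-theory of spheres (Hatcher VBKT §2). [folklore] -/
theorem mapsTo_prodMap_prodWedge {x₀' : X'} {y₀' : Y'} {x₀ : X} {y₀ : Y} (f : C(X', X)) (g : C(Y', Y)) (hf : f x₀' = x₀) (hg : g y₀' = y₀) :
    MapsTo (f.prodMap g) (prodWedge x₀' y₀') (prodWedge x₀ y₀) := by
  rintro ⟨x, y⟩ (h | h)
  · left; change f x = x₀; rw [show x = x₀' from h, hf]
  · right; change g y = y₀; rw [show y = y₀' from h, hg]

/-- The map `f ∧ g : X' ∧ Y' → X ∧ Y` of smash products induced by pointed maps. [folklore] -/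
def smashMap {x₀' : X'} {y₀' : Y'} {x₀ : X} {y₀ : Y} (f : C(X', X)) (g : C(Y', Y)) (hf : f x₀' = x₀) (hg : g y₀' = y₀) :
    C(Smash x₀' y₀', Smash x₀ y₀) :=
  Collapse.map (f.prodMap g) (mapsTo_prodMap_prodWedge f g hf hg)

omit [CompactSpace X] [CompactSpace Y] [CompactSpace X'] [CompactSpace Y'] in
/-- K-theory of spheres (Hatcher VBKT §2). [folklore] -/
theorem smashMap_comp_mk {x₀' : X'} {y₀' : Y'} {x₀ : X} {y₀ : Y} (f : C(X', X)) (g : C(Y', Y)) (hf : f x₀' = x₀) (hg : g y₀' = y₀) :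
    (smashMap f g hf hg).comp (Collapse.mk (prodWedgeC x₀' y₀')) = (Collapse.mk (prodWedgeC x₀ y₀)).comp (f.prodMap g) := rfl

omit [CompactSpace X] [CompactSpace Y] [CompactSpace X'] [CompactSpace Y'] in
/-- K-theory of spheres (Hatcher VBKT §2). [folklore] -/
@[simp] theorem smashMap_pt {x₀' : X'} {y₀' : Y'} {x₀ : X} {y₀ : Y} (f : C(X', X)) (g : C(Y', Y)) (hf : f x₀' = x₀) (hg : g y₀' = y₀) :
    smashMap f g hf hg (Collapse.pt _) = Collapse.pt _ := rfl

/-- **Naturality**: `(f ∧ g)^*(a ∧ b) = f^*a ∧ g^*b`. [cite: HusemollerFibreBundles1994, Ch. 10 Rem. 3.6] -/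
theorem pullback_smashMap_smashProd {x₀' : X'} {y₀' : Y'} {x₀ : X} {y₀ : Y} (f : C(X', X)) (g : C(Y', Y)) (hf : f x₀' = x₀) (hg : g y₀' = y₀)
    (a : Reduced X x₀) (b : Reduced Y y₀) :
    pullback (smashMap f g hf hg) (smashProd x₀ y₀ a b : K0 (Smash x₀ y₀)) =
      (smashProd x₀' y₀' ⟨pullback f a, by rw [mem_reduced_iff, rankAt_pullback, hf]; exact a.2⟩ ⟨pullback g b, by rw [mem_reduced_iff, rankAt_pullback, hg]; exact b.2⟩ : K0 (Smash x₀' y₀')) := by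
  symm
  refine smashProd_eq_of_quotK_eq x₀' y₀' _ _ (pullback_mem_reduced (by rw [smashMap_pt]; exact (smashProd x₀ y₀ a b).2)) ?_
  rw [quotK, ← AddMonoidHom.comp_apply, ← pullback_comp, smashMap_comp_mk, pullback_comp, AddMonoidHom.comp_apply]
  change pullback (f.prodMap g) (quotK (prodWedgeC x₀ y₀) (smashProd x₀ y₀ a b : K0 (Smash x₀ y₀))) = _
  have e1 : (ContinuousMap.fst : C(X × Y, X)).comp (f.prodMap g) = f.comp ContinuousMap.fst := rfl
  have e2 : (ContinuousMap.snd : C(X × Y, Y)).comp (f.prodMap g) = g.comp ContinuousMap.snd := rfl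
  rw [quotK_smashProd, eprod, pullback_mul, ← AddMonoidHom.comp_apply, ← pullback_comp, e1, ← AddMonoidHom.comp_apply (pullback (f.prodMap g)),
    ← pullback_comp, e2, pullback_comp, pullback_comp]
  rfl

end SmashProd

/-! ### Compatibility with reduced Bott periodicity: `a ∧ (γ₀ - 1) = smashBott⁻¹(a)` -/

section BottCompat

variable {X : Type u} [TopologicalSpace X] [CompactSpace X] [T2Space X]

/-- The Bott class on `S²` itself, `γ₀ = j^*γ_{pt} ∈ K⁰(S²)`. [cite: HusemollerFibreBundles1994, Ch. 11 Notation 2.7] -/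
def bottγ₀ : K0 S2r := pullback ((ContinuousMap.const S2r ()).prodMk (ContinuousMap.id S2r)) (bottγ Unit)

/-- K-theory of spheres (Hatcher VBKT §2). [folklore] -/
theorem pullback_snd_bottγ₀ : pullback (ContinuousMap.snd : C(X × S2r, S2r)) bottγ₀ = bottγ X := pullback_snd_bottγ_unit X

/-- The reduced Bott class `γ₀ - 1 ∈ K̃(S²)`. [cite: HusemollerFibreBundles1994, Ch. 11 Cor. 5.5] -/
def bottβ₂ (s₀ : S2r) : Reduced S2r s₀ := ⟨bottγ₀ - 1, by rw [mem_reduced_iff, map_sub, bottγ₀, rankAt_bottγ_unit, rankAt_one, sub_self]⟩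

/-- K-theory of spheres (Hatcher VBKT §2). [folklore] -/
@[simp] theorem coe_bottβ₂ (s₀ : S2r) : (bottβ₂ s₀ : K0 S2r) = bottγ₀ - 1 := rfl

/-- **`a ∧ (γ₀ - 1) = smashBott⁻¹(a)`**: the `K̃`-cup product with the Bott class of `S²` is the inverse
of reduced Bott periodicity. [cite: HusemollerFibreBundles1994, Ch. 11 Thm. 5.4] -/
theorem smashProd_bottβ₂ (x₀ : X) (s₀ : S2r) (a : Reduced X x₀) : smashProd x₀ s₀ a (bottβ₂ s₀) = (smashBott X x₀ s₀).symm a := by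
  apply Subtype.ext
  apply smashProd_eq_of_quotK_eq x₀ s₀ a (bottβ₂ s₀) ((smashBott X x₀ s₀).symm a).2
  change quotK (wedgeXS x₀ s₀) ((smashBott X x₀ s₀).symm a : K0 (SmashS2 X x₀ s₀)) = _
  rw [quotK_smashBott_symm, eprod, coe_bottβ₂, map_sub, pullback_snd_bottγ₀, pullback_one]

/-- **Reduced Bott periodicity, product form**: `a ↦ a ∧ (γ₀ - 1)` is an isomorphism
`K̃(X) ≅ K̃(X ∧ S²)`. [cite: HusemollerFibreBundles1994, Ch. 11 Thm. 5.4] -/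
theorem smashProd_bottβ₂_bijective (x₀ : X) (s₀ : S2r) : Function.Bijective (fun a : Reduced X x₀ ↦ smashProd x₀ s₀ a (bottβ₂ s₀)) := by
  have : (fun a : Reduced X x₀ ↦ smashProd x₀ s₀ a (bottβ₂ s₀)) = (smashBott X x₀ s₀).symm := funext (smashProd_bottβ₂ x₀ s₀)
  rw [this]; exact (smashBott X x₀ s₀).symm.bijective

end BottCompat

/-! ### Relative products `K(X, A) ⊗ K(X, B) → K(X, A ∪ B)` -/

section RelProd

variable {X : Type u} [TopologicalSpace X] [CompactSpace X] [T2Space X] {A B : Closeds X}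

/-- The reduced diagonal `X/(A ∪ B) → (X/A) ∧ (X/B)`. [cite: HusemollerFibreBundles1994, Ch. 10 Def. 3.7] -/
def redDiag (A B : Closeds X) : C(Collapse X (A ⊔ B), Smash (Collapse.pt A) (Collapse.pt B)) :=
  Collapse.lift ((Collapse.mk (prodWedgeC (Collapse.pt A) (Collapse.pt B))).comp ((Collapse.mk A).prodMk (Collapse.mk B))) (Collapse.pt _)
    (by
      rintro x (hx | hx)
      · exact Collapse.mk_eq_pt (Or.inl (Collapse.mk_eq_pt hx))
      · exact Collapse.mk_eq_pt (Or.inr (Collapse.mk_eq_pt hx)))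

/-- K-theory of spheres (Hatcher VBKT §2). [folklore] -/
theorem redDiag_comp_mk (A B : Closeds X) :
    (redDiag A B).comp (Collapse.mk (A ⊔ B)) = (Collapse.mk (prodWedgeC (Collapse.pt A) (Collapse.pt B))).comp ((Collapse.mk A).prodMk (Collapse.mk B)) := rfl

/-- K-theory of spheres (Hatcher VBKT §2). [folklore] -/
@[simp] theorem redDiag_pt (A B : Closeds X) : redDiag A B (Collapse.pt _) = Collapse.pt _ := rfl

/-- **The relative product** `K(X, A) ⊗ K(X, B) → K(X, A ∪ B)` (`K(X, A) = K̃(X/A)`): pull back the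
`K̃`-cup product along the reduced diagonal. [cite: HusemollerFibreBundles1994, Ch. 10 Def. 3.7] -/
def relProd (a : Reduced (Collapse X A) (Collapse.pt A)) (b : Reduced (Collapse X B) (Collapse.pt B)) : Reduced (Collapse X (A ⊔ B)) (Collapse.pt _) :=
  ⟨pullback (redDiag A B) (smashProd (Collapse.pt A) (Collapse.pt B) a b : K0 (Smash (Collapse.pt A) (Collapse.pt B))),
    pullback_mem_reduced (by rw [redDiag_pt]; exact (smashProd _ _ a b).2)⟩

/-- K-theory of spheres (Hatcher VBKT §2). [folklore] -/
@[simp] theorem coe_relProd (a : Reduced (Collapse X A) (Collapse.pt A)) (b : Reduced (Collapse X B) (Collapse.pt B)) :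
    (relProd a b : K0 (Collapse X (A ⊔ B))) =
      pullback (redDiag A B) (smashProd (Collapse.pt A) (Collapse.pt B) a b : K0 (Smash (Collapse.pt A) (Collapse.pt B))) := rfl

/-- **`q_{A∪B}^*(a · b) = q_A^*a · q_B^*b` in `K⁰(X)`**: the relative product refines the product of the
absolute images. [cite: HusemollerFibreBundles1994, Ch. 10 Def. 3.7] -/
theorem quotK_relProd (a : Reduced (Collapse X A) (Collapse.pt A)) (b : Reduced (Collapse X B) (Collapse.pt B)) :
    quotK (A ⊔ B) (relProd a b : K0 (Collapse X (A ⊔ B))) = quotK A a * quotK B b := by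
  rw [coe_relProd, quotK, ← AddMonoidHom.comp_apply, ← pullback_comp, redDiag_comp_mk, pullback_comp, AddMonoidHom.comp_apply,
    pullback_mk_smashProd, eprod, pullback_mul, ← AddMonoidHom.comp_apply, ← pullback_comp,
    ← AddMonoidHom.comp_apply (pullback ((Collapse.mk A).prodMk (Collapse.mk B))), ← pullback_comp]
  rfl

/-- K-theory of spheres (Hatcher VBKT §2). [folklore] -/
theorem relProd_add_left (a a' : Reduced (Collapse X A) (Collapse.pt A)) (b : Reduced (Collapse X B) (Collapse.pt B)) :
    relProd (a + a') b = relProd a b + relProd a' b := by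
  apply Subtype.ext
  change pullback (redDiag A B) (smashProd _ _ (a + a') b : K0 _) = pullback (redDiag A B) (smashProd _ _ a b : K0 _) + pullback (redDiag A B) (smashProd _ _ a' b : K0 _)
  rw [smashProd_add_left, AddSubgroup.coe_add, map_add]

/-- K-theory of spheres (Hatcher VBKT §2). [folklore] -/
theorem relProd_add_right (a : Reduced (Collapse X A) (Collapse.pt A)) (b b' : Reduced (Collapse X B) (Collapse.pt B)) :
    relProd a (b + b') = relProd a b + relProd a b' := by
  apply Subtype.ext
  change pullback (redDiag A B) (smashProd _ _ a (b + b') : K0 _) = pullback (redDiag A B) (smashProd _ _ a b : K0 _) + pullback (redDiag A B) (smashProd _ _ a b' : K0 _)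
  rw [smashProd_add_right, AddSubgroup.coe_add, map_add]

end RelProd

end Literature.AlgebraicTopology.KTheory

end
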